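import Summits.BirchSwinnertonDyer.BirchSwinnertonDyer.Theorems.KimAtThreeDeepLowerOffStratumNonAdditiveRows
import Summits.BirchSwinnertonDyer.Rank1Residual.Partition.YanZhuImForm
import Literature.NumberTheory.EllipticCurves.SemistablePeuRamifieRamifiedPrime
import HarnessLib

/-!
# Route `KimAtThreeKolyvagin` (rung W2), crux `DeepLowerAtThreeOffKatoStratum` (item 19679), registered
# stub `stub_nonAdditive` VERBATIM: its residue RE-TYPED as two corner lower-half families — good
# SUPERSINGULAR `3`, and NON-semistable multiplicative `3` without (ram) — plus Tamagawa divisibility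

Cell `bsd-addord`, seat `bsd-addord-w2-acc2` (PROGRAMME PART 1b, ACCEL-LIST row (2)), gen 2; item
`stmt-BirchSwinnertonDyer-19679` (BC3 skeleton `DeepLowerAtThreeOffKatoStratum_birth.lean`, sha16
`e575d03075635394`; the owner w2-c2 assembles via `DeepLowerAtThreeOffKatoStratum_of`). Companion of
`KimAtThreeDeepLowerOffStratumSemistable` (this seat, same session: on SEMISTABLE rows (ram) is a theorem —
`Literature.NumberTheory.EllipticCurves.ram_three_of_semistable_of_irr`, Ribet 1990 to level one — so the
multiplicative-`3`-without-(ram) rows of gen 0's residue are all NON-semistable). Theorems only; every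
printed input is a hypothesis BY NAME; residual families are DISPLAYED; nothing asserted; the crux stays
OPEN; BSD is not proved by any of this.

* `missingLowerBoundAt_three_of_not_addv_of_cornerLowerHalves` — Miller's lower half `MissingLowerBoundAt W 3`
  on EVERY non-additive tower row of analytic rank `0` from SEVEN named facts (`hYZ`, `hW20`, `hSk`, `hmod`,
  `hGZK`, `hBCDT`, `hLL`) and TWO displayed corner families: (L_ss) the lower half on good-SUPERSINGULAR-`3`
  tower rows of analytic rank `0` (corners X6/X7/X8 at `3`: Kobayashi 2003 / Wuthrich 2014 Prop. 21 print
  the UPPER half only; the signed-IMC lower bound is announced — BSTW arXiv:2409.01350 — or conditional —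
  Sprung 2024 —, and the cell takes no `_OPEN` input), (L_m) the lower half on NON-SEMISTABLE
  multiplicative-`3` tower rows of analytic rank `0` WITHOUT (ram) (corner X11a at `3` off the square-free
  conductors, e.g. `N = 3·r²` with `r` additive: Skinner 2016 Thm. C needs (ram); nothing else is printed at
  an irreducible multiplicative `3`).
* ★★ `stub_nonAdditive_of_cornerLowerHalves_of_tamagawa_le_deepInfty` — the registered stub VERBATIM from
  EIGHT named facts (+ Mazur 1978 Cor. 4.1 `hM` for the period transfer) and THREE displayed families
  (L_ss), (L_m), (TD) TamDiv-deep on the `3 ∣ ∏ c_ℓ` rows — gen 0's ★ theorem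
  `stub_nonAdditive_of_missingLowerBoundAt_of_tamagawa_le_deepInfty` with its family (L) SHRUNK from «all
  good-supersingular and all multiplicative-without-(ram) rows» to (L_ss) ∪ (L_m);
  ★★′ `…_of_bigIm` — the same with Yan–Zhu 2026 Thm. 4.15 in its PRINTED (Im) form (litref p454928's
  `yanZhu_thm415_of_thm415_of_bigIm`; plan l.812 hygiene: a wrapper, not an edit of a landed file).
RESIDUE OF THE STUB after this file, typed: (L_ss) ∪ (L_m) ∪ (TD) [(TD) at exponent `m` ⟸ the owner's
(LL_m), `KimAtThreeDeepLowerTamagawaLevelLowering`]. [cite: YanZhu2024MainConjNonCM, Thm. 4.15 (§4.6)]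
[cite: Skinner2016PacificMC, Thm. C (§1), §2.5] [cite: Ribet1990, Thm. 1.1] [cite: Diamond1995RefinedSerre, Thm. 1.1]
[cite: Wuthrich2014, Lemma 20 (p. 399), Prop. 21 (p. 400)] [cite: Kobayashi2003, Thm. 1.3 (p. 2) and Thm. 4.1 (p. 8)] [cite: Mazur1978, Cor. 4.1]
[cite: Kim2022StructureSelmer, §1.5.1, Conj. 1.10 (PDF pp. 7–8)] [cite: Miller2011LMS, Def. 1.1]
-/


set_option autoImplicit false
-- the Theorems namespace of a single-conjunct summit repeats the summit name by design (D-0017)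
set_option linter.dupNamespace false

noncomputable section

open scoped MatrixGroups ModularForm Classical

open CongruenceSubgroup WeierstrassCurve Literature.NumberTheory.EllipticCurves
  Literature.NumberTheory.EllipticCurves.ModularForms
  Literature.NumberTheory.EllipticCurves.Rank1Residual
  Literature.NumberTheory.EllipticCurves.Rank1Residual.Typed
  Literature.NumberTheory.EllipticCurves.Skinner2016
  Literature.NumberTheory.EllipticCurves.SteinWuthrich2013
  Literature.NumberTheory.Automorphic
  Summit.BirchSwinnertonDyer.BirchSwinnertonDyer.Theorems.Rank1ResidualX1Defs

namespace Summit.BirchSwinnertonDyer.BirchSwinnertonDyer.Theorems.KimAtThreeDeepLowerOffStratumResidue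

open Summit.BirchSwinnertonDyer.Rank1Residual
open Summit.BirchSwinnertonDyer.BirchSwinnertonDyer.Theses.KimAtThreeKolyvagin
open Summit.BirchSwinnertonDyer.BirchSwinnertonDyer.Theorems.KimAtThreeKolyvaginUnitLevelOneRungs
open Summit.BirchSwinnertonDyer.BirchSwinnertonDyer.Theorems.KimAtThreeDeepLowerSmallDefect
open Summit.BirchSwinnertonDyer.BirchSwinnertonDyer.Theorems.KimAtThreeDeepLowerNonAdditiveRows
open Summit.BirchSwinnertonDyer.BirchSwinnertonDyer.Theorems.KimAtThreeShallowEqDeepOffStratumSockets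
open Summit.BirchSwinnertonDyer.BirchSwinnertonDyer.Theorems.KimAtThreeShallowEqDeepOffStratumNonAdditiveRows
open Summit.BirchSwinnertonDyer.BirchSwinnertonDyer.Theorems.KimAtThreeDeepLowerOffStratumSockets
open Summit.BirchSwinnertonDyer.BirchSwinnertonDyer.Theorems.KimAtThreeDeepLowerOffStratumNonAdditiveRows

/-! ### §3 The registered stub VERBATIM: the residue re-typed as two corner families + TamDiv-deep -/

section Residue

/-- **Miller's lower half on EVERY non-additive tower row of analytic rank `0`, from the named facts and
the two corner families.** Case split at `3`: good ordinary ⟹ row C16 (Yan–Zhu `hYZ`, Wuthrich L20 `hW20`);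
good supersingular ⟹ the displayed family (L_ss); multiplicative with (ram) ⟹ row C1 (Skinner `hSk`);
multiplicative, semistable ⟹ (ram) is automatic (`ram_three_of_semistable_of_irr`: `hBCDT`, `hLL`) ⟹
row C1; multiplicative, NOT semistable, no (ram) ⟹ the displayed family (L_m).
[cite: YanZhu2024MainConjNonCM, Thm. 4.15 (§4.6)] [cite: Skinner2016PacificMC, Thm. C (§1)]
[cite: Ribet1990, Thm. 1.1] [cite: Miller2011LMS, Def. 1.1] -/
theorem missingLowerBoundAt_three_of_not_addv_of_cornerLowerHalves
    (hYZ : YanZhu2026.thm415_padicValRat_bsd_rank_le_one)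
    (hW20 : Wuthrich2014.lemma20_surjective_threeAdic_of_semistable)
    (hSk : Skinner2016.thmC_padicValRat_bsd_rank_zero)
    (hmod : hasEntireLFunction_rat) (hGZK : rank_eq_analyticRank_of_analyticRank_le_one)
    (hBCDT : exists_isNewformOf) (hLL : diamond1995_refinedSerre)
    (hLss : ∀ (W : WeierstrassCurve ℚ) [W.IsElliptic] [W.IsGloballyMinimal],
      (∀ n : ℕ, W.HasSurjectiveModNGaloisRep (3 ^ n : ℕ)) → W.analyticRank = 0 →
      W.HasGoodReductionAtPrime 3 → (3 : ℤ) ∣ W.frobeniusTrace 3 → MissingLowerBoundAt W 3)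
    (hLm : ∀ (W : WeierstrassCurve ℚ) [W.IsElliptic] [W.IsGloballyMinimal],
      (∀ n : ℕ, W.HasSurjectiveModNGaloisRep (3 ^ n : ℕ)) → W.analyticRank = 0 →
      W.HasMultiplicativeReductionAtPrime 3 → ¬ Semistable W →
      ¬ (haveI : Fact (Nat.Prime 3) := ⟨Nat.prime_three⟩; Ram W 3) → MissingLowerBoundAt W 3)
    (W : WeierstrassCurve ℚ) [W.IsElliptic] [W.IsGloballyMinimal]
    (htower : ∀ n : ℕ, W.HasSurjectiveModNGaloisRep (3 ^ n : ℕ)) (hr0 : W.analyticRank = 0)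
    (hnA : ¬ (haveI : Fact (Nat.Prime 3) := ⟨Nat.prime_three⟩; Addv W 3)) :
    MissingLowerBoundAt W 3 := by
  haveI : Fact (Nat.Prime 3) := ⟨Nat.prime_three⟩
  have hirr : W.HasIrreducibleModPGaloisRep 3 :=
    hasIrreducibleModPGaloisRep_of_hasSurjectiveModNGaloisRep W 3 (by simpa using htower 1)
  by_cases hgood : W.HasGoodReductionAtPrime 3
  · by_cases hord3 : (3 : ℤ) ∣ W.frobeniusTrace 3
    · exact hLss W htower hr0 hgood hord3
    · exact missingLowerBoundAt_three_of_goodOrd_of_towerSurj W hYZ hW20 hmod hGZK htower hr0 hgood hord3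
  · have hmult : W.HasMultiplicativeReductionAtPrime 3 := by
      by_contra h
      exact hnA ⟨hgood, h⟩
    by_cases hram : Ram W 3
    · exact missingLowerBoundAt_three_of_rowC1_of_skinner W hSk hmod hGZK hr0 hirr (Or.inr hmult) hram
    · by_cases hsst : Semistable W
      · exact absurd (ram_three_of_semistable_of_irr hBCDT hLL W hsst hirr) hram
      · exact hLm W htower hr0 hmult hsst hram

/-- ★★ **The registered stub `stub_nonAdditive` of crux 19679, VERBATIM, from EIGHT named facts and THREE
displayed residual families** — the residue of gen 0 (`stub_nonAdditive_of_missingLowerBoundAt_of_tamagawa_le_deepInfty`: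
(L) on all good-supersingular and all multiplicative-without-(ram) rows) RE-TYPED and shrunk:
(L_ss) Miller's lower half on the good-SUPERSINGULAR-`3` tower rows of analytic rank `0` (corners X6/X7/X8
at `3`; one-sided in print), (L_m) Miller's lower half on the NON-SEMISTABLE multiplicative-`3` tower rows of
analytic rank `0` WITHOUT (ram) (corner X11a at `3` off the square-free conductors; on semistable curves
(ram) is a theorem), (TD) TamDiv-deep on the `3 ∣ ∏ c_ℓ` rows. Named facts: Yan–Zhu 2026 Thm. 4.15
(`hYZ`), Wuthrich 2014 L20 (`hW20`), Skinner 2016 Thm. C (`hSk`), modularity (`hmod`, `hBCDT`), GZK, Mazur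
1978 Cor. 4.1 (`hM`), Ribet 1990 / Diamond 1995 (`hLL`). [cite: YanZhu2024MainConjNonCM, Thm. 4.15 (§4.6)]
[cite: Skinner2016PacificMC, Thm. C (§1)] [cite: Ribet1990, Thm. 1.1] [cite: Mazur1978, Cor. 4.1]
[cite: Kim2022StructureSelmer, Conj. 1.10 (PDF p. 8)] [cite: Miller2011LMS, Def. 1.1] -/
theorem stub_nonAdditive_of_cornerLowerHalves_of_tamagawa_le_deepInfty
    (hYZ : YanZhu2026.thm415_padicValRat_bsd_rank_le_one)
    (hW20 : Wuthrich2014.lemma20_surjective_threeAdic_of_semistable)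
    (hSk : Skinner2016.thmC_padicValRat_bsd_rank_zero)
    (hmod : hasEntireLFunction_rat) (hGZK : rank_eq_analyticRank_of_analyticRank_le_one)
    (hM : mazur_not_dvd_maninConstant_of_odd)
    (hBCDT : exists_isNewformOf) (hLL : diamond1995_refinedSerre)
    (hLss : ∀ (W : WeierstrassCurve ℚ) [W.IsElliptic] [W.IsGloballyMinimal],
      (∀ n : ℕ, W.HasSurjectiveModNGaloisRep (3 ^ n : ℕ)) → W.analyticRank = 0 →
      W.HasGoodReductionAtPrime 3 → (3 : ℤ) ∣ W.frobeniusTrace 3 → MissingLowerBoundAt W 3)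
    (hLm : ∀ (W : WeierstrassCurve ℚ) [W.IsElliptic] [W.IsGloballyMinimal],
      (∀ n : ℕ, W.HasSurjectiveModNGaloisRep (3 ^ n : ℕ)) → W.analyticRank = 0 →
      W.HasMultiplicativeReductionAtPrime 3 → ¬ Semistable W →
      ¬ (haveI : Fact (Nat.Prime 3) := ⟨Nat.prime_three⟩; Ram W 3) → MissingLowerBoundAt W 3)
    (hTD : ∀ (W : WeierstrassCurve ℚ) [W.IsElliptic] [W.IsGloballyMinimal],
      (∀ n : ℕ, W.HasSurjectiveModNGaloisRep (3 ^ n : ℕ)) →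
      ∀ {N : ℕ} [NeZero N] (f : CuspForm (Gamma0 N) 2), IsNewformOf W f →
      kuriharaVanishingOrder W 3 f = 0 →
      ¬ (haveI : Fact (Nat.Prime 3) := ⟨Nat.prime_three⟩; Addv W 3) → 3 ∣ W.tamagawaProduct →
        ((padicValNat 3 W.tamagawaProduct : ℕ) : ℕ∞) ≤ kuriharaPartialDeepInfty W 3 f) :
    ∀ (W₀ : WeierstrassCurve ℚ) [W₀.IsElliptic] [W₀.IsGloballyMinimal],
      (∀ n : ℕ, W₀.HasSurjectiveModNGaloisRep (3 ^ n : ℕ)) → Finite W₀.sha →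
      ∀ {N : ℕ} [NeZero N], N = W₀.conductorNorm ℤ →
      ∀ (D₀ : ModularParametrizationData W₀ N),
        (∀ z ∈ D₀.L.lattice, ∃ w ∈ periodLattice D₀.f, z = D₀.c * w) →
        (∀ (W₂ : WeierstrassCurve ℚ) [W₂.IsElliptic] (D₂ : ModularParametrizationData W₂ N),
          D₂.f = D₀.f → D₀.modularDegree ≤ D₂.modularDegree) →
        (∀ r : ℚ, ratPlusSymbol D₀.f r ≠ 0 → 0 ≤ padicValRat 3 (ratPlusSymbol D₀.f r)) →
        kuriharaVanishingOrder W₀ 3 D₀.f = 0 →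
        ¬ (haveI : Fact (Nat.Prime 3) := ⟨Nat.prime_three⟩; Addv W₀ 3) →
        ∃ d : ℕ, kuriharaPartialDeepInfty W₀ 3 D₀.f = d ∧
          kuriharaPartial W₀ 3 D₀.f 0 ≤
            ((padicValNat 3 (Nat.card (AddCommGroup.primaryComponent W₀.sha 3)) + d : ℕ) : ℕ∞) :=
  stub_nonAdditive_of_missingLowerBoundAt_of_tamagawa_le_deepInfty hM hGZK
    (fun W _ _ htower hr0 hnA =>
      missingLowerBoundAt_three_of_not_addv_of_cornerLowerHalves hYZ hW20 hSk hmod hGZK hBCDT hLL hLss hLm W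
        htower hr0 hnA)
    hTD

/-- ★★′ **The same with Yan–Zhu's theorem in its PRINTED (Im) form** (`hYZ'`: Thm. 4.15 under (Im), litref
`thm415_padicValRat_bsd_rank_le_one_of_bigIm`; the special-case binder is DERIVED by the kernel theorem
`yanZhu_thm415_of_thm415_of_bigIm` — tower-surjective ⟹ (Im) — plan l.812 hygiene for the C16 socket).
[cite: YanZhu2024MainConjNonCM, Thm. 4.15 (§4.6) and §4.3 (the (Im) hypothesis)] [cite: Skinner2016PacificMC, §2.5, Thm. C]
[cite: Ribet1990, Thm. 1.1] [cite: Mazur1978, Cor. 4.1] [cite: Miller2011LMS, Def. 1.1] -/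
theorem stub_nonAdditive_of_cornerLowerHalves_of_tamagawa_le_deepInfty_of_bigIm
    (hYZ' : YanZhu2026.thm415_padicValRat_bsd_rank_le_one_of_bigIm)
    (hW20 : Wuthrich2014.lemma20_surjective_threeAdic_of_semistable)
    (hSk : Skinner2016.thmC_padicValRat_bsd_rank_zero)
    (hmod : hasEntireLFunction_rat) (hGZK : rank_eq_analyticRank_of_analyticRank_le_one)
    (hM : mazur_not_dvd_maninConstant_of_odd)
    (hBCDT : exists_isNewformOf) (hLL : diamond1995_refinedSerre)
    (hLss : ∀ (W : WeierstrassCurve ℚ) [W.IsElliptic] [W.IsGloballyMinimal],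
      (∀ n : ℕ, W.HasSurjectiveModNGaloisRep (3 ^ n : ℕ)) → W.analyticRank = 0 →
      W.HasGoodReductionAtPrime 3 → (3 : ℤ) ∣ W.frobeniusTrace 3 → MissingLowerBoundAt W 3)
    (hLm : ∀ (W : WeierstrassCurve ℚ) [W.IsElliptic] [W.IsGloballyMinimal],
      (∀ n : ℕ, W.HasSurjectiveModNGaloisRep (3 ^ n : ℕ)) → W.analyticRank = 0 →
      W.HasMultiplicativeReductionAtPrime 3 → ¬ Semistable W →
      ¬ (haveI : Fact (Nat.Prime 3) := ⟨Nat.prime_three⟩; Ram W 3) → MissingLowerBoundAt W 3)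
    (hTD : ∀ (W : WeierstrassCurve ℚ) [W.IsElliptic] [W.IsGloballyMinimal],
      (∀ n : ℕ, W.HasSurjectiveModNGaloisRep (3 ^ n : ℕ)) →
      ∀ {N : ℕ} [NeZero N] (f : CuspForm (Gamma0 N) 2), IsNewformOf W f →
      kuriharaVanishingOrder W 3 f = 0 →
      ¬ (haveI : Fact (Nat.Prime 3) := ⟨Nat.prime_three⟩; Addv W 3) → 3 ∣ W.tamagawaProduct →
        ((padicValNat 3 W.tamagawaProduct : ℕ) : ℕ∞) ≤ kuriharaPartialDeepInfty W 3 f) :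
    ∀ (W₀ : WeierstrassCurve ℚ) [W₀.IsElliptic] [W₀.IsGloballyMinimal],
      (∀ n : ℕ, W₀.HasSurjectiveModNGaloisRep (3 ^ n : ℕ)) → Finite W₀.sha →
      ∀ {N : ℕ} [NeZero N], N = W₀.conductorNorm ℤ →
      ∀ (D₀ : ModularParametrizationData W₀ N),
        (∀ z ∈ D₀.L.lattice, ∃ w ∈ periodLattice D₀.f, z = D₀.c * w) →
        (∀ (W₂ : WeierstrassCurve ℚ) [W₂.IsElliptic] (D₂ : ModularParametrizationData W₂ N),
          D₂.f = D₀.f → D₀.modularDegree ≤ D₂.modularDegree) →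
        (∀ r : ℚ, ratPlusSymbol D₀.f r ≠ 0 → 0 ≤ padicValRat 3 (ratPlusSymbol D₀.f r)) →
        kuriharaVanishingOrder W₀ 3 D₀.f = 0 →
        ¬ (haveI : Fact (Nat.Prime 3) := ⟨Nat.prime_three⟩; Addv W₀ 3) →
        ∃ d : ℕ, kuriharaPartialDeepInfty W₀ 3 D₀.f = d ∧
          kuriharaPartial W₀ 3 D₀.f 0 ≤
            ((padicValNat 3 (Nat.card (AddCommGroup.primaryComponent W₀.sha 3)) + d : ℕ) : ℕ∞) :=
  stub_nonAdditive_of_cornerLowerHalves_of_tamagawa_le_deepInfty (yanZhu_thm415_of_thm415_of_bigIm hYZ')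
    hW20 hSk hmod hGZK hM hBCDT hLL hLss hLm hTD

end Residue

end Summit.BirchSwinnertonDyer.BirchSwinnertonDyer.Theorems.KimAtThreeDeepLowerOffStratumResidue

end
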